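import Literature.AlgebraicGeometry.Motives.HodgeThetaSubalgebraReductive
import Literature.AlgebraicGeometry.Motives.SpanCRationalRadicalDescent
import Literature.AlgebraicGeometry.Motives.HodgeLieRigidModuloCentre
import HarnessLib

/-!
# The radical kill: a rational invariant form on the derived algebra of an admissible `Θ`-subalgebra whose radical commutes
# with `Θ` has ZERO radical (Deligne LNM 900 I Prop. 3.6, Moonen–Zarhin 1999 §1 — the mechanism of the tree's
# `SpBlocksThetaSix` skeleton exclusion, extracted for every admissible algebra)

Topic `Literature/AlgebraicGeometry/Motives` (namespace `Literature.AlgebraicGeometry.Motives.HodgeStructure`).  Theorems only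
(no definition, no named fact; D-0026).  Written for the cell `pub-hodgeav-hg6` (req-37 (A) row 2, TABLE X rows 1 `g6.I(1)` and
8-`(4,2)`: the rank-twelve `End⁰ = ℚ` case tree and the unitary `(4,2)` programme, brick U1, lead g2 2026-08-28T21:14:20Z /
21:16:44Z; honest framing of that cell: HC / HC_AV / HC_CM / H2 NOT proved — THIS file is unconditional Hodge–Lie linear algebra
and discharges no hypothesis of the cell's cover).

THE MECHANISM.  In the tree's type-I rank-six programme (`HodgeThetaSubalgebraSymplecticBlocksRankSix`, `SpBlocksThetaSix.*`) the
E³-type SKELETON `𝔰𝔩₂ ⊗ 1 + 1 ⊗ 𝔰𝔬₃` of a six-dimensional block is not excluded over `ℂ` (Moonen–Zarhin (2.5)) but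
ARITHMETICALLY: the rational invariant form `Ψ = tr_V − 2m·κ` acquires a non-zero complex radical vector on a skeleton block, hence
(`spanC_exists_rational_radical`, Hoffman–Kunze §1.4: rational linear systems solvable over `ℂ` are solvable over `ℚ`) a non-zero
RATIONAL radical vector `X`, which commutes with `Θ` (`SpBlocksThetaSix.comm_theta_of_radical`), hence is a Hodge endomorphism
(Zarhin / Deligne I 3.6), hence central in the admissible algebra — and a central element of the derived algebra is `0`
(`HodgeThetaSubalgebraReductive`: the trace form is negative definite on the centre).  The same two closing steps serve EVERY
skeleton of EVERY admissible algebra; this file states them once, for an arbitrary `ℂ`-bilinear form with rational values on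
rational pairs:

* **`ThetaSubalgebra.eq_zero_of_mem_derived_of_commute_theta`** — for `𝔤 ⊆ End_ℚ(V)` rational, bracket-closed, `ψ`-skew,
  commuting with `End_Hdg(V)`, with `Θ ∈ 𝔤_ℂ`: a RATIONAL element `X` of the derived algebra `𝔡(𝔤) = span_ℚ {[A, B]}` whose
  complexification commutes with `Θ` is `0` (`mem_endAlg_of_commute_theta` ⟹ `X ∈ End_Hdg` ⟹ `X` central ⟹
  `𝔷(𝔤) ∩ 𝔡(𝔤) = 0`, `ThetaSubalgebra.center_inf_derived_eq_bot`).
* **`ThetaSubalgebra.eq_zero_of_radical_of_forall_radical_commute_theta`** — THE RADICAL KILL: for any `ℂ`-bilinear `Ψ` on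
  `𝔡(𝔤)_ℂ = spanC 𝔡(𝔤)` taking rational values on `(X_ℂ, Y_ℂ)`, `X, Y ∈ 𝔡(𝔤)`: if every `Ψ`-radical vector (orthogonal to all
  `Y_ℂ`, `Y ∈ 𝔡(𝔤)`) commutes with `Θ`, then every `Ψ`-radical vector is `0`.
INTENDED USES (not in this file): the unitary `(4,2)` skeleton `ℂ ⊕ 𝔰𝔩₂⊗1 ⊕ 1⊗𝔰𝔩₃` on `W = ℂ² ⊗ ℂ³` (radical of
`tr_W − ¾κ` on the derived algebra = `𝔰𝔩₂ ⊗ 1`, commuting with `T = Θ|_W ∈ 1 ⊗ 𝔤𝔩₃`), and the symplectic rank-twelve skeleton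
`𝔰𝔩₂ ⊕ 𝔰𝔬₆` on `ℂ² ⊗ ℂ⁶` (TABLE X rows 8-`(4,2)` and 1): each complex core then only has to OUTPUT «full, or a non-zero radical
vector of a named rational invariant form whose radical commutes with `Θ`».

## References

* [Deligne1982HodgeCycles] P. Deligne, *Hodge cycles on abelian varieties*, LNM 900 (1982), I §3 Prop. 3.4, Prop. 3.6.
* [MoonenZarhin1999LowDim] B. Moonen, Yu. Zarhin, Math. Ann. 315 (1999), §1 (centre of `Hg` inside the centre of `End⁰`),
  §2 (2.3)–(2.5).
* [HoffmanKunze1971LinearAlgebra] K. Hoffman, R. Kunze, *Linear Algebra* (1971), §1.4 closing remark, §5.4.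
* [Humphreys1972] J. E. Humphreys, GTM 9 (1972), §5.1 (radical of an invariant form is an ideal), §19.1.
-/

noncomputable section

open scoped TensorProduct

namespace Literature.AlgebraicGeometry.Motives

namespace HodgeStructure

universe u

variable {V : Type u} [AddCommGroup V] [Module ℚ V] [Module.Finite ℚ V] {n : ℤ}

/-- **A rational element of the derived algebra commuting with `Θ` vanishes.**  For `𝔤 ⊆ End_ℚ(V)` rational, bracket-closed,
`ψ`-skew, commuting with `End_Hdg(V)`, with `Θ ∈ 𝔤_ℂ`, and `X ∈ 𝔡(𝔤) = span_ℚ {AB − BA : A, B ∈ 𝔤}` with `X_ℂ Θ = Θ X_ℂ`: `X` is a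
Hodge endomorphism (`mem_endAlg_of_commute_theta`), so it commutes with `𝔤`, i.e. `X ∈ 𝔷(𝔤) ∩ 𝔡(𝔤) = 0`
(`ThetaSubalgebra.center_inf_derived_eq_bot`: `tr(Z²) < 0` on non-zero central `Z`).  Moonen–Zarhin §1: «the centre of `Hg(X)` is
contained in the centre of `End⁰(X)`». [cite: Deligne1982HodgeCycles, I §3 Prop. 3.6] [cite: MoonenZarhin1999LowDim, §1] -/
theorem ThetaSubalgebra.eq_zero_of_mem_derived_of_commute_theta (H : HodgeStructure V n) (ψ : H.Polarization)
    (𝔤 : Submodule ℚ (Module.End ℚ V)) (hbr : ∀ X ∈ 𝔤, ∀ Y ∈ 𝔤, X * Y - Y * X ∈ 𝔤)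
    {Θ : Module.End ℂ (ℂ ⊗[ℚ] V)} (hΘ : ∀ p, ∀ x ∈ H.piece p (n - p), Θ x = ((2 * p - n : ℤ) : ℂ) • x)
    (hΘ𝔤 : Θ ∈ spanC 𝔤)
    (hcomm : ∀ X ∈ 𝔤, ∀ a : H.endAlg, X * (a : Module.End ℚ V) = (a : Module.End ℚ V) * X)
    (hskew : ∀ X ∈ 𝔤, ∀ v w, ψ.form (X v) w + ψ.form v (X w) = 0)
    {X : Module.End ℚ V} (hX : X ∈ Submodule.span ℚ {B | ∃ X ∈ 𝔤, ∃ Y ∈ 𝔤, X * Y - Y * X = B})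
    (hXΘ : X.baseChange ℂ * Θ = Θ * X.baseChange ℂ) : X = 0 := by
  have hXE : X ∈ H.endAlg := mem_endAlg_of_commute_theta H hΘ hXΘ
  have hX𝔤 : X ∈ 𝔤 := Literature.Algebra.Lie.TraceSeparating.derived_le 𝔤 hbr hX
  have hXc : X ∈ Subalgebra.toSubmodule (Subalgebra.centralizer ℚ (𝔤 : Set (Module.End ℚ V))) := by
    rw [Subalgebra.mem_toSubmodule, Subalgebra.mem_centralizer_iff]
    intro Y hY
    exact hcomm Y hY ⟨X, hXE⟩
  have hbot := ThetaSubalgebra.center_inf_derived_eq_bot H ψ 𝔤 hΘ hΘ𝔤 hskew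
  have hmem : X ∈ 𝔤 ⊓ Subalgebra.toSubmodule (Subalgebra.centralizer ℚ (𝔤 : Set (Module.End ℚ V))) ⊓
      Submodule.span ℚ {B | ∃ X ∈ 𝔤, ∃ Y ∈ 𝔤, X * Y - Y * X = B} := ⟨⟨hX𝔤, hXc⟩, hX⟩
  rw [hbot, Submodule.mem_bot] at hmem
  exact hmem

/-- **THE RADICAL KILL.**  Let `𝔤 ⊆ End_ℚ(V)` be rational, bracket-closed, `ψ`-skew, commuting with `End_Hdg(V)`, with
`Θ ∈ 𝔤_ℂ`, `𝔡 = 𝔡(𝔤)` its derived algebra, and `Ψ` ANY `ℂ`-bilinear form on `spanC 𝔡` with RATIONAL values on the pairs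
`(X_ℂ, Y_ℂ)`, `X, Y ∈ 𝔡` (e.g. `tr_V − c·κ`, `c ∈ ℚ`).  If every `Ψ`-radical vector of `spanC 𝔡` commutes with `Θ`, then every
`Ψ`-radical vector is ZERO: a non-zero one would give a non-zero RATIONAL radical vector (`spanC_exists_rational_radical`), which
commutes with `Θ`, contradicting `eq_zero_of_mem_derived_of_commute_theta`.  This is the closing argument of the tree's rank-six
skeleton exclusion (`SpBlocksThetaSix`, «a nonzero rational radical vector … commutes with `Θ` … is central, hence `ψ`-self-adjoint
and `ψ`-skew, `= 0`»), stated for every admissible algebra and every rational invariant form.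
[cite: Deligne1982HodgeCycles, I §3 Prop. 3.4 and Prop. 3.6] [cite: MoonenZarhin1999LowDim, §1 and §2 (2.5)]
[cite: HoffmanKunze1971LinearAlgebra, §1.4 closing remark and §5.4] -/
theorem ThetaSubalgebra.eq_zero_of_radical_of_forall_radical_commute_theta (H : HodgeStructure V n)
    (ψ : H.Polarization) (𝔤 : Submodule ℚ (Module.End ℚ V)) (hbr : ∀ X ∈ 𝔤, ∀ Y ∈ 𝔤, X * Y - Y * X ∈ 𝔤)
    {Θ : Module.End ℂ (ℂ ⊗[ℚ] V)} (hΘ : ∀ p, ∀ x ∈ H.piece p (n - p), Θ x = ((2 * p - n : ℤ) : ℂ) • x)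
    (hΘ𝔤 : Θ ∈ spanC 𝔤)
    (hcomm : ∀ X ∈ 𝔤, ∀ a : H.endAlg, X * (a : Module.End ℚ V) = (a : Module.End ℚ V) * X)
    (hskew : ∀ X ∈ 𝔤, ∀ v w, ψ.form (X v) w + ψ.form v (X w) = 0)
    (Ψ : ↥(spanC (Submodule.span ℚ {B | ∃ X ∈ 𝔤, ∃ Y ∈ 𝔤, X * Y - Y * X = B})) →ₗ[ℂ]
      ↥(spanC (Submodule.span ℚ {B | ∃ X ∈ 𝔤, ∃ Y ∈ 𝔤, X * Y - Y * X = B})) →ₗ[ℂ] ℂ)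
    (hrat : ∀ (X : Module.End ℚ V) (hX : X ∈ Submodule.span ℚ {B | ∃ X ∈ 𝔤, ∃ Y ∈ 𝔤, X * Y - Y * X = B})
      (Y : Module.End ℚ V) (hY : Y ∈ Submodule.span ℚ {B | ∃ X ∈ 𝔤, ∃ Y ∈ 𝔤, X * Y - Y * X = B}), ∃ q : ℚ,
      Ψ ⟨X.baseChange ℂ, baseChange_mem_spanC hX⟩ ⟨Y.baseChange ℂ, baseChange_mem_spanC hY⟩ = (q : ℂ))
    (hradΘ : ∀ Z : ↥(spanC (Submodule.span ℚ {B | ∃ X ∈ 𝔤, ∃ Y ∈ 𝔤, X * Y - Y * X = B})),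
      (∀ (Y : Module.End ℚ V) (hY : Y ∈ Submodule.span ℚ {B | ∃ X ∈ 𝔤, ∃ Y ∈ 𝔤, X * Y - Y * X = B}),
        Ψ Z ⟨Y.baseChange ℂ, baseChange_mem_spanC hY⟩ = 0) →
      (Z : Module.End ℂ (ℂ ⊗[ℚ] V)) * Θ = Θ * (Z : Module.End ℂ (ℂ ⊗[ℚ] V)))
    {Z : ↥(spanC (Submodule.span ℚ {B | ∃ X ∈ 𝔤, ∃ Y ∈ 𝔤, X * Y - Y * X = B}))}
    (hZrad : ∀ (Y : Module.End ℚ V) (hY : Y ∈ Submodule.span ℚ {B | ∃ X ∈ 𝔤, ∃ Y ∈ 𝔤, X * Y - Y * X = B}),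
      Ψ Z ⟨Y.baseChange ℂ, baseChange_mem_spanC hY⟩ = 0) :
    Z = 0 := by
  by_contra hZ0
  obtain ⟨X, hX, hX0, hXrad⟩ :=
    spanC_exists_rational_radical (Submodule.span ℚ {B | ∃ X ∈ 𝔤, ∃ Y ∈ 𝔤, X * Y - Y * X = B}) Ψ hrat hZ0 hZrad
  have hXrad' : ∀ (Y : Module.End ℚ V) (hY : Y ∈ Submodule.span ℚ {B | ∃ X ∈ 𝔤, ∃ Y ∈ 𝔤, X * Y - Y * X = B}),
      Ψ ⟨X.baseChange ℂ, baseChange_mem_spanC hX⟩ ⟨Y.baseChange ℂ, baseChange_mem_spanC hY⟩ = 0 :=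
    fun Y hY => hXrad _
  have hXΘ : X.baseChange ℂ * Θ = Θ * X.baseChange ℂ := hradΘ ⟨X.baseChange ℂ, baseChange_mem_spanC hX⟩ hXrad'
  exact hX0 (ThetaSubalgebra.eq_zero_of_mem_derived_of_commute_theta H ψ 𝔤 hbr hΘ hΘ𝔤 hcomm hskew hX hXΘ)

/-- **The radical kill for `𝔤 = Lie Hg(H)`** (which is rational, bracket-closed, `ψ`-skew, commutes with `End_Hdg(V)` and
contains the Hodge operator after complexification — `hodgeLie_standing`): every rational invariant form on the derived algebra
of `Lie Hg` whose radical commutes with `Θ` has zero radical. [cite: Deligne1982HodgeCycles, I §3 Prop. 3.4 and Prop. 3.6]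
[cite: MoonenZarhin1999LowDim, §1] -/
theorem hodgeLie_eq_zero_of_radical_of_forall_radical_commute_theta [HodgeTensorFacts.{u, u}] (H : HodgeStructure V n)
    (ψ : H.Polarization) {Θ : Module.End ℂ (ℂ ⊗[ℚ] V)}
    (hΘ : ∀ p, ∀ x ∈ H.piece p (n - p), Θ x = ((2 * p - n : ℤ) : ℂ) • x) (hΘ𝔤 : Θ ∈ spanC H.hodgeLie)
    (Ψ : ↥(spanC (Submodule.span ℚ {B | ∃ X ∈ H.hodgeLie, ∃ Y ∈ H.hodgeLie, X * Y - Y * X = B})) →ₗ[ℂ]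
      ↥(spanC (Submodule.span ℚ {B | ∃ X ∈ H.hodgeLie, ∃ Y ∈ H.hodgeLie, X * Y - Y * X = B})) →ₗ[ℂ] ℂ)
    (hrat : ∀ (X : Module.End ℚ V) (hX : X ∈ Submodule.span ℚ {B | ∃ X ∈ H.hodgeLie, ∃ Y ∈ H.hodgeLie, X * Y - Y * X = B})
      (Y : Module.End ℚ V) (hY : Y ∈ Submodule.span ℚ {B | ∃ X ∈ H.hodgeLie, ∃ Y ∈ H.hodgeLie, X * Y - Y * X = B}),
      ∃ q : ℚ, Ψ ⟨X.baseChange ℂ, baseChange_mem_spanC hX⟩ ⟨Y.baseChange ℂ, baseChange_mem_spanC hY⟩ = (q : ℂ))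
    (hradΘ : ∀ Z : ↥(spanC (Submodule.span ℚ {B | ∃ X ∈ H.hodgeLie, ∃ Y ∈ H.hodgeLie, X * Y - Y * X = B})),
      (∀ (Y : Module.End ℚ V) (hY : Y ∈ Submodule.span ℚ {B | ∃ X ∈ H.hodgeLie, ∃ Y ∈ H.hodgeLie, X * Y - Y * X = B}),
        Ψ Z ⟨Y.baseChange ℂ, baseChange_mem_spanC hY⟩ = 0) →
      (Z : Module.End ℂ (ℂ ⊗[ℚ] V)) * Θ = Θ * (Z : Module.End ℂ (ℂ ⊗[ℚ] V)))
    {Z : ↥(spanC (Submodule.span ℚ {B | ∃ X ∈ H.hodgeLie, ∃ Y ∈ H.hodgeLie, X * Y - Y * X = B}))}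
    (hZrad : ∀ (Y : Module.End ℚ V) (hY : Y ∈ Submodule.span ℚ {B | ∃ X ∈ H.hodgeLie, ∃ Y ∈ H.hodgeLie, X * Y - Y * X = B}),
      Ψ Z ⟨Y.baseChange ℂ, baseChange_mem_spanC hY⟩ = 0) :
    Z = 0 := by
  obtain ⟨hbr, hskew, hcomm, -⟩ := hodgeLie_standing H ψ
  exact ThetaSubalgebra.eq_zero_of_radical_of_forall_radical_commute_theta H ψ H.hodgeLie hbr hΘ hΘ𝔤 hcomm hskew Ψ hrat
    hradΘ hZrad

end HodgeStructure

end Literature.AlgebraicGeometry.Motives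

end
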